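import Mathlib
import Literature.MathematicalPhysics.QuantumFieldTheory.Balaban1983to89.B6Ineq244BoxProof

/-!
# `Balaban1983to89.B6Ineq243BoxProof` — T. Bałaban, *Propagators and renormalization transformations for lattice gauge
theories. II*, Commun. Math. Phys. **96** (1984) 223–250 [Balaban1984PropagatorsII]: **(2.43)₁ for the Dirichlet local
inverses `G′(□) = (□Δ′_a□)⁻¹` and Proposition 2.2 (2.67)₁ for `G′ = Δ′_a⁻¹` on the one-scale box model with NO displayed
hypothesis left** — the random-walk chain (2.36)–(2.38), (2.43), (2.44), (2.50), (2.64)–(2.66) of this seat's gens 1–2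
(`…B6Ineq249Proof`, `…B6Ineq266Proof`, `…B6Ineq244BoxProof`) closed for every symmetric, coercive, nearest-neighbour Δ′_a

statement-level skeleton of published theorems with citation tags; proofs where landed; nothing here is a claim about the Yang–Mills mass gap.
PDF held: `paper:balaban1984-cmp96-propagators-rt-ii` (journal page = PDF page + 222); pp. 229–235 [PDF 7–13] read this
session (`lit read paper:balaban1984-cmp96-propagators-rt-ii --pages 7-16` and the ×2 render
`run/shared/lean/pub/pub-balaban/b2b-balaban-ref1/pages/1984-cmp96-propagators-rt-II/1984-cmp96-propagators-rt-II-p013-x2.png`).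

CITATION HEADER (cell `lit-balaban`, Phase-2 proof seat `p01` (gen 3) = unit `lit-balaban-p01`, HOME
`run/shared/lean/pub/lit-balaban/`, `PHASE2-TARGETS.md` §G, G.5-34(d)); SKELETON rows **`B6.Eq2.41`** ((2.43)₁, kind
«model-instance»: PROVED for the concrete Dirichlet local inverses on the one-scale box) and **`B6.Prop2.2`** ((2.67)₁, kind
«model-instance», now with no hypothesis of printed shape); companions of this seat IMPORTED, not modified: `…B6Ineq244BoxProof` (p244807/p247703: (2.43) ⇒ (2.44), (2.43) ⇒ (2.66)), `…B6Ineq266Proof`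
(p244416), `…B6Ineq249Proof` (p243144/p243405).  Reused BY NAME: `QGQInverse.Coercive/inverse_decay/isUnit_of_coercive`
(finite Combes–Thomas, cell pub-balaban unit r1-g3 — the mechanism by which the tree proves the Sect. 5 Theorem (5.7) of
[3] = [Balaban1983RegularityDecay], `B4Sect5Proof`), `B6CoverBox.bdist/cubeInd/hprof/Kbox/cubeInd_mul_hprof` (the printed
cover of (2.36) in coordinates, unit b06-g17), `B6Ineq244BoxProof.weightedRange_of_nearestNeighbour/box_kernel266_of_243`.
WHAT THE PAPER PRINTS.  p. 229 [PDF 7], (2.37): *"G′₀ = Σ_{□∈𝒟} h_□G′(□)h_□, where G′(□) is an inverse of Δ′_a with some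
boundary conditions on the boundary of □, e.g. with Neumann boundary conditions as in [3]"*; p. 230 [PDF 8], (2.43):
*"|(G′(□)λ)(x)|, |(∂^{L^{−j}}_μG′(□)λ)(x)| ≤ O(1)e^{−δ₀dist(x,supp λ)}|λ|"* (*"from Lemmas 2.2, 2.4, Proposition 2.3 [3]"*);
p. 234 [PDF 12], Proposition 2.2: *"If we have (2.1), (2.2) and M is sufficiently large, then the operator G′ = Δ′_a^{−1}
(a = 1) satisfies the inequalities |(G′λ)(x)| … ≤ O(1)(L^jη)²e^{−½δ₀d(y,y′)}|λ| … (2.67)"*; p. 235 [PDF 13]: *"Our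
considerations are analogous to Sect. 5 of [3], concerning unit lattice operators. If we have one scale, i.e. Λ_k =
T₁^{(k)}, then the operator is a unit lattice operator."*; (2.13) p. 225: *"Δ′_a = Δ + Q′*aQ′ … (Q′₀λ)(x) = λ(x) on Λ₀"*.
WHAT IS PROVED HERE (0 sorry, 0 new definitions, 0 named facts), on the box 𝔅 = {0,…,nM}^d of `B6CoverBox` (blocks =
sites, one scale, ℓ¹ distance `bdist`), for an ARBITRARY symmetric matrix `Δ′_a` with `⟨v, Δ′_av⟩ ≥ γ‖v‖²` (γ > 0; the
positivity (2.11)), `Δ′_a(x,y) = 0` for `|x − y|₁ > 1` and off-diagonal absolute row sums `≤ κ₀`: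
§1 `inv_entry_decay` — finite Combes–Thomas on the box: `|Δ′_a⁻¹(x,y)| ≤ (γ − κ₀(e^{δ₀} − 1))⁻¹e^{−δ₀|x−y|₁}` for every
  `δ₀ ≥ 0` with `κ₀(e^{δ₀} − 1) < γ` (the Sect. 5 (5.7) mechanism of [3] on this carrier).
§2 the DIRICHLET LOCAL INVERSES `G′(□_k) = □_kP_k⁻¹□_k`, `P_k = □_kΔ′_a□_k + γ(1 − □_k)` (= `(□_kΔ′_a□_k)⁻¹` on ℓ²(□_k)
  extended by zero — the `C_Λ = (ΛAΛ)⁻¹` of [3] Sect. 5; P_k is symmetric, γ-coercive, nearest-neighbour with the same κ₀):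
  **`localInverse_decay`** = (2.43)₁ `|G′(□_k)(x,y)| ≤ (γ − κ₀(e^{δ₀} − 1))⁻¹e^{−δ₀|x−y|₁}` uniformly in k and in the
  volume; **`localInverse_identity`** = the local-inverse property `h_kΔ′_aG′(□_k)h_k = h_kh_k` behind (2.37)–(2.38)
  (h_k = the cut-off of (2.36), supp h_k ⊂ □_k).
§3 the dictionary to the `Module.End` operators of the chain (`toLin_*`) and **`prop22_entry1_box`**: for `0 < δ₀`,
  `κ₀(e^{δ₀} − 1) < γ`, `0 < α ≤ 1` and *"M sufficiently large"* EXPLICITLY `M > 2^d(3π/2)Aκ₀e^{δ₀}K(αδ₀)`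
  (A = (γ − κ₀(e^{δ₀} − 1))⁻¹, K(a) = (2(1 − e^{−a})⁻¹)^d): **`|Δ′_a⁻¹(x,y)| ≤ 2^dAK(αδ₀)(1 − 2^d(3π/2)Aκ₀e^{δ₀}M⁻¹K(αδ₀))⁻¹
  e^{−(1−α)δ₀|x−y|₁}`** uniformly in the volume — `B6Ineq244BoxProof.box_kernel266_of_243` (gen 2: (2.43) ALONE ⇒ (2.66))
  with ALL its inputs `hGD` (G′Δ′_a = I), `hloc`, `hD` (weighted range κ₀e^{δ₀}), `h243` DISCHARGED.  The companion
  `…B6Prop22BoxLaplacian` (same seat) instantiates Δ′_a = −Δ + a (the printed (2.13) on one scale, κ₀ = 2d).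
ROUTE / HONEST SCOPE (declared deviations).  (i) G′(□) is taken with DIRICHLET conditions (compression), where print says
*"some boundary conditions … e.g. with Neumann"* — any local inverse with (2.43) and `h_□Δ′_aG′(□)h_□ = h_□²` serves the
chain.  (ii) (2.43)₁ is obtained by the finite Combes–Thomas bound of the tree (`QGQInverse.inverse_decay`), the route
by which the tree proves [3]'s Sect. 5 Theorem, not via (2.41)–(2.42) + Lemmas 2.2, 2.4, Prop. 2.3 of [3] (whose one-scale,
j = 0 content is that theorem).  (iii) On this finite-dimensional model the CONCLUSION of `prop22_entry1_box` also follows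
in one line from `inv_entry_decay` applied to Δ′_a itself (better constant, rate δ₀): the value certified is that the
PRINTED random-walk route closes on the model with no hypothesis of printed shape left, not a new estimate.  NOT treated:
fine lattices X ≠ 𝔅 / several scales (`…B6Ineq266Proof` §1 covers them with (2.43)/(2.44) as hypotheses), the
derivative entry of (2.43), entries 2–6 of (2.67), the torus.
-/

namespace Literature.MathematicalPhysics.QuantumFieldTheory.Balaban1983to89.B6Ineq243BoxProof

open Finset Matrix
open B6CoverBox (hprof bdist Kbox cubeInd bdist_self bdist_comm bdist_triangle bdist_nonneg hprof_nonneg hprof_le_one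
  cubeInd_zero_or_one cubeInd_mul_hprof)
open QGQInverse (Coercive inverse_decay isUnit_of_coercive mulVec_single_one_apply)

variable {d S : ℕ}

/-! ## §1. Finite Combes–Thomas on the box: a symmetric coercive nearest-neighbour matrix has a decaying inverse -/

/-- Weighted absolute row sums of a nearest-neighbour matrix on the box (`A(x,y) = 0` for `|x − y|₁ > 1`, off-diagonal
absolute row sums `≤ κ₀`): `Σ_y |A(x,y)|(e^{δ₀|x−y|₁} − 1) ≤ κ₀(e^{δ₀} − 1)` (the diagonal carries e⁰ − 1 = 0). [folklore] -/
private theorem weightedRowSum_le {A : Matrix (Fin d → Fin S) (Fin d → Fin S) ℝ} {δ₀ κ₀ : ℝ} (hδ₀ : 0 ≤ δ₀)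
    (hnn : ∀ x y, 1 < bdist x y → A x y = 0)
    (hrow : ∀ x, ∑ y ∈ Finset.univ.filter (fun y => y ≠ x), |A x y| ≤ κ₀) (x : Fin d → Fin S) :
    ∑ y, |A x y| * (Real.exp (δ₀ * bdist x y) - 1) ≤ κ₀ * (Real.exp δ₀ - 1) := by
  have hk1 : 0 ≤ Real.exp δ₀ - 1 := by linarith [Real.add_one_le_exp δ₀]
  have hterm : ∀ y, |A x y| * (Real.exp (δ₀ * bdist x y) - 1) ≤
      if y ≠ x then |A x y| * (Real.exp δ₀ - 1) else 0 := by
    intro y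
    by_cases hy : y ≠ x
    · rw [if_pos hy]
      by_cases hfar : 1 < bdist x y
      · rw [hnn x y hfar, abs_zero, zero_mul, zero_mul]
      · refine mul_le_mul_of_nonneg_left ?_ (abs_nonneg _)
        have h1 : δ₀ * bdist x y ≤ δ₀ := by
          have := mul_le_mul_of_nonneg_left (not_lt.mp hfar) hδ₀
          rwa [mul_one] at this
        linarith [Real.exp_le_exp.mpr h1]
    · rw [if_neg hy, not_ne_iff.mp hy, bdist_self, mul_zero, Real.exp_zero, sub_self, mul_zero]
  calc ∑ y, |A x y| * (Real.exp (δ₀ * bdist x y) - 1)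
      ≤ ∑ y, (if y ≠ x then |A x y| * (Real.exp δ₀ - 1) else 0) := Finset.sum_le_sum fun y _ => hterm y
    _ = (∑ y ∈ Finset.univ.filter (fun y => y ≠ x), |A x y|) * (Real.exp δ₀ - 1) := by
        rw [Finset.sum_mul, Finset.sum_filter]
    _ ≤ κ₀ * (Real.exp δ₀ - 1) := mul_le_mul_of_nonneg_right (hrow x) hk1

/-- **Finite Combes–Thomas on the box** (the tree's `QGQInverse.inverse_decay` in the ℓ¹ lattice distance): a symmetric
matrix `A` on the box with `⟨v, Av⟩ ≥ γ‖v‖²`, `A(x,y) = 0` for `|x − y|₁ > 1` and off-diagonal absolute row sums `≤ κ₀`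
has `|A⁻¹(x,y)| ≤ (γ − κ₀(e^{δ₀} − 1))⁻¹e^{−δ₀|x−y|₁}` for every `δ₀ ≥ 0` with `κ₀(e^{δ₀} − 1) < γ` — an instance (Λ = Ω = the
box, finite-range A) of the Sect. 5 Theorem of [3], p. 594: *"A ≥ γ₀I, |A(x,x′)| ≤ c₀e^{−δ₀|x−x′|} (5.6). Then …
|C_Λ(x,x′)| ≤ c₁e^{−δ₁|x−x′|} (5.7)"*, by the mechanism with which the tree proves that theorem (`B4Sect5Proof`).
[cite: Balaban1983RegularityDecay, Thm p.594 (5.7)] -/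
theorem inv_entry_decay {A : Matrix (Fin d → Fin S) (Fin d → Fin S) ℝ} {γ δ₀ κ₀ : ℝ} (hsymm : A.IsSymm)
    (hcoer : Coercive A γ) (hδ₀ : 0 ≤ δ₀) (hρ : κ₀ * (Real.exp δ₀ - 1) < γ)
    (hnn : ∀ x y, 1 < bdist x y → A x y = 0)
    (hrow : ∀ x, ∑ y ∈ Finset.univ.filter (fun y => y ≠ x), |A x y| ≤ κ₀) (x y : Fin d → Fin S) :
    |A⁻¹ x y| ≤ (γ - κ₀ * (Real.exp δ₀ - 1))⁻¹ * Real.exp (-(δ₀ * bdist x y)) :=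
  inverse_decay A bdist hρ hδ₀ hcoer bdist_comm bdist_self bdist_triangle
    (fun i => weightedRowSum_le hδ₀ hnn hrow i)
    (fun j => by
      have key := weightedRowSum_le hδ₀ hnn hrow j
      calc ∑ i, |A i j| * (Real.exp (δ₀ * bdist i j) - 1)
          = ∑ i, |A j i| * (Real.exp (δ₀ * bdist j i) - 1) :=
            Finset.sum_congr rfl fun i _ => by rw [hsymm.apply i j, bdist_comm]
        _ ≤ κ₀ * (Real.exp δ₀ - 1) := key)
    x y


/-! ## §2. The Dirichlet local inverses `G′(□_k) = (□_kΔ′_a□_k)⁻¹`: (2.43)₁ and `h_kΔ′_aG′(□_k)h_k = h_kh_k` -/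

section LocalInverse

variable {n m : ℕ}

/-- 0 ≤ □_k. [folklore] -/
private theorem cubeInd_nonneg (m : ℕ) (k : Fin d → Fin (n + 1)) (x : Fin d → Fin S) : 0 ≤ cubeInd m k x := by
  rcases cubeInd_zero_or_one m k x with h | h <;> norm_num [h]

/-- □_k ≤ 1. [folklore] -/
private theorem cubeInd_le_one (m : ℕ) (k : Fin d → Fin (n + 1)) (x : Fin d → Fin S) : cubeInd m k x ≤ 1 := by
  rcases cubeInd_zero_or_one m k x with h | h <;> norm_num [h]

/-- □_k² = □_k. [folklore] -/
private theorem cubeInd_mul_self (m : ℕ) (k : Fin d → Fin (n + 1)) (x : Fin d → Fin S) :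
    cubeInd m k x * cubeInd m k x = cubeInd m k x := by
  rcases cubeInd_zero_or_one m k x with h | h <;> norm_num [h]

variable {Dm P : Matrix (Fin d → Fin S) (Fin d → Fin S) ℝ} {γ δ₀ κ₀ : ℝ} {k : Fin d → Fin (n + 1)}

/-- The padded compression `P = □_kΔ′_a□_k + γ(1 − □_k)` ([3] Sect. 5 *"A_Λ = ΛAΛ"*, completed by γ·identity off the
cube so that it is invertible on the whole box) is symmetric when Δ′_a is. [folklore] -/
private theorem padded_isSymm (hsymm : Dm.IsSymm)
    (hP : ∀ x y, P x y = cubeInd m k x * Dm x y * cubeInd m k y +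
      γ * (1 - cubeInd m k x) * (if x = y then 1 else 0)) : P.IsSymm := by
  refine Matrix.IsSymm.ext fun x y => ?_
  rw [hP, hP, hsymm.apply x y]
  by_cases hxy : x = y
  · subst hxy; rfl
  · rw [if_neg hxy, if_neg (Ne.symm hxy)]; ring

/-- Expansion of a quadratic form in matrix entries: `⟨v, Pv⟩ = Σ_x Σ_y v(x)P(x,y)v(y)`. [folklore] -/
private theorem dotProduct_mulVec_eq_sum (P : Matrix (Fin d → Fin S) (Fin d → Fin S) ℝ) (v : (Fin d → Fin S) → ℝ) :
    v ⬝ᵥ (P *ᵥ v) = ∑ x, ∑ y, v x * P x y * v y := by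
  simp only [dotProduct, Matrix.mulVec, Finset.mul_sum, mul_assoc]

/-- The padded compression inherits the coercivity: `⟨v, Pv⟩ = ⟨□v, Δ′_a□v⟩ + γ‖(1 − □)v‖² ≥ γ‖v‖²`. [folklore] -/
private theorem padded_coercive (hcoer : Coercive Dm γ)
    (hP : ∀ x y, P x y = cubeInd m k x * Dm x y * cubeInd m k y +
      γ * (1 - cubeInd m k x) * (if x = y then 1 else 0)) : Coercive P γ := by
  intro v
  set w : (Fin d → Fin S) → ℝ := fun x => cubeInd m k x * v x with hw
  have hsplit : v ⬝ᵥ (P *ᵥ v) = w ⬝ᵥ (Dm *ᵥ w) + γ * ∑ x, (1 - cubeInd m k x) * (v x * v x) := by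
    rw [dotProduct_mulVec_eq_sum, dotProduct_mulVec_eq_sum, Finset.mul_sum, ← Finset.sum_add_distrib]
    refine Finset.sum_congr rfl fun x _ => ?_
    have h1 : ∀ y, v x * P x y * v y =
        w x * Dm x y * w y + γ * ((1 - cubeInd m k x) * (v x * (if x = y then v y else 0))) := by
      intro y
      rw [hP, hw]
      by_cases hxy : x = y
      · rw [if_pos hxy, if_pos hxy]; ring
      · rw [if_neg hxy, if_neg hxy]; ring
    rw [Finset.sum_congr rfl fun y _ => h1 y, Finset.sum_add_distrib, ← Finset.mul_sum, ← Finset.mul_sum,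
      ← Finset.mul_sum, Finset.sum_ite_eq]
    simp
  have hvv : γ * (v ⬝ᵥ v) = γ * (w ⬝ᵥ w) + γ * ∑ x, (1 - cubeInd m k x) * (v x * v x) := by
    rw [← mul_add]
    congr 1
    simp only [dotProduct, hw, ← Finset.sum_add_distrib]
    refine Finset.sum_congr rfl fun x _ => ?_
    have := cubeInd_mul_self m k x
    calc v x * v x = (cubeInd m k x * cubeInd m k x + (1 - cubeInd m k x)) * (v x * v x) := by rw [this]; ring
      _ = _ := by ring
  rw [hsplit, hvv]
  exact add_le_add (hcoer w) le_rfl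

/-- The padded compression is again nearest-neighbour. [folklore] -/
private theorem padded_nn (hnn : ∀ x y, 1 < bdist x y → Dm x y = 0)
    (hP : ∀ x y, P x y = cubeInd m k x * Dm x y * cubeInd m k y +
      γ * (1 - cubeInd m k x) * (if x = y then 1 else 0)) :
    ∀ x y, 1 < bdist x y → P x y = 0 := by
  intro x y hxy
  have hne : x ≠ y := by
    rintro rfl
    rw [bdist_self] at hxy
    linarith
  rw [hP, hnn x y hxy, if_neg hne]
  ring

/-- The padded compression has off-diagonal absolute row sums `≤ κ₀` if Δ′_a has (|□_k| ≤ 1). [folklore] -/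
private theorem padded_row (hrow : ∀ x, ∑ y ∈ Finset.univ.filter (fun y => y ≠ x), |Dm x y| ≤ κ₀)
    (hP : ∀ x y, P x y = cubeInd m k x * Dm x y * cubeInd m k y +
      γ * (1 - cubeInd m k x) * (if x = y then 1 else 0)) :
    ∀ x, ∑ y ∈ Finset.univ.filter (fun y => y ≠ x), |P x y| ≤ κ₀ := by
  intro x
  refine le_trans (Finset.sum_le_sum fun y hy => ?_) (hrow x)
  have hne : y ≠ x := (Finset.mem_filter.mp hy).2
  rw [hP, if_neg (Ne.symm hne), mul_zero, add_zero, abs_mul, abs_mul, abs_of_nonneg (cubeInd_nonneg m k x),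
    abs_of_nonneg (cubeInd_nonneg m k y)]
  calc cubeInd m k x * |Dm x y| * cubeInd m k y ≤ 1 * |Dm x y| * 1 :=
        mul_le_mul (mul_le_mul_of_nonneg_right (cubeInd_le_one m k x) (abs_nonneg _)) (cubeInd_le_one m k y)
          (cubeInd_nonneg m k y) (by positivity)
    _ = |Dm x y| := by ring

/-- **(2.43), first entry, for the Dirichlet local inverses on the one-scale box.**  p. 230: *"|(G′(□)λ)(x)| … ≤
O(1)e^{−δ₀dist(x,supp λ)}|λ|"* (2.43), G′(□) *"an inverse of Δ′_a with some boundary conditions on the boundary of □"*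
(p. 229).  For ANY symmetric `Δ′_a` with `⟨v, Δ′_av⟩ ≥ γ‖v‖²`, `Δ′_a(x,y) = 0` for `|x − y|₁ > 1` and off-diagonal absolute
row sums `≤ κ₀`, the Dirichlet local inverse `G′(□_k) = □_kP⁻¹□_k` (`P = □_kΔ′_a□_k + γ(1 − □_k)`; = `(□_kΔ′_a□_k)⁻¹` on
ℓ²(□_k) extended by zero, the `C_Λ = (ΛAΛ)⁻¹` of [3] Sect. 5) satisfies for every `δ₀ ≥ 0` with `κ₀(e^{δ₀} − 1) < γ`:
**`|G′(□_k)(x,y)| ≤ (γ − κ₀(e^{δ₀} − 1))⁻¹·e^{−δ₀|x−y|₁}`**, uniformly in the cube and the volume (finite Combes–Thomas;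
print: *"from Lemmas 2.2, 2.4, Proposition 2.3 [3]"*, on one scale [3]'s Sect. 5 Theorem (5.7)).
[cite: Balaban1984PropagatorsII, (2.43) p.230] -/
theorem localInverse_decay (hsymm : Dm.IsSymm) (hcoer : Coercive Dm γ) (hδ₀ : 0 ≤ δ₀)
    (hρ : κ₀ * (Real.exp δ₀ - 1) < γ) (hnn : ∀ x y, 1 < bdist x y → Dm x y = 0)
    (hrow : ∀ x, ∑ y ∈ Finset.univ.filter (fun y => y ≠ x), |Dm x y| ≤ κ₀)
    (hP : ∀ x y, P x y = cubeInd m k x * Dm x y * cubeInd m k y +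
      γ * (1 - cubeInd m k x) * (if x = y then 1 else 0)) (x y : Fin d → Fin S) :
    |cubeInd m k x * P⁻¹ x y * cubeInd m k y| ≤ (γ - κ₀ * (Real.exp δ₀ - 1))⁻¹ * Real.exp (-(δ₀ * bdist x y)) := by
  have key := inv_entry_decay (padded_isSymm hsymm hP) (padded_coercive hcoer hP) hδ₀ hρ (padded_nn hnn hP)
    (padded_row hrow hP) x y
  have hA : 0 ≤ (γ - κ₀ * (Real.exp δ₀ - 1))⁻¹ * Real.exp (-(δ₀ * bdist x y)) :=
    mul_nonneg (inv_nonneg.mpr (by linarith)) (Real.exp_nonneg _)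
  rw [abs_mul, abs_mul, abs_of_nonneg (cubeInd_nonneg m k x), abs_of_nonneg (cubeInd_nonneg m k y)]
  calc cubeInd m k x * |P⁻¹ x y| * cubeInd m k y ≤ 1 * |P⁻¹ x y| * 1 :=
        mul_le_mul (mul_le_mul_of_nonneg_right (cubeInd_le_one m k x) (abs_nonneg _)) (cubeInd_le_one m k y)
          (cubeInd_nonneg m k y) (by positivity)
    _ = |P⁻¹ x y| := by ring
    _ ≤ _ := key

/-- **The local-inverse property of (2.37)–(2.38) for the Dirichlet local inverses**: with `h_k` = multiplication by the
cut-off of (2.36) (`supp h_k ⊂ □_k`, `B6CoverBox.inCube_of_hprof_ne_zero`) and `G′(□_k) = □_kP⁻¹□_k` as above,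
**`h_kΔ′_aG′(□_k)h_k = h_kh_k`** as matrices — the identity that makes `Δ′_aG′₀ = I − R` (2.38) hold (here from
`h_k□_k = h_k`, `□_kΔ′_a□_k = P − γ(1 − □_k)`, `h_k(1 − □_k) = 0` and `PP⁻¹ = 1`, P being invertible as a coercive matrix).
[cite: Balaban1984PropagatorsII, (2.37)–(2.38) p.229] -/
theorem localInverse_identity (hm : 0 < m) (hγ : 0 < γ) (hcoer : Coercive Dm γ)
    (hP : ∀ x y, P x y = cubeInd m k x * Dm x y * cubeInd m k y +
      γ * (1 - cubeInd m k x) * (if x = y then 1 else 0)) :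
    diagonal (hprof m k : (Fin d → Fin S) → ℝ) * Dm * (diagonal (cubeInd m k : (Fin d → Fin S) → ℝ) * P⁻¹ * diagonal (cubeInd m k : (Fin d → Fin S) → ℝ)) * diagonal (hprof m k : (Fin d → Fin S) → ℝ) =
      diagonal (hprof m k : (Fin d → Fin S) → ℝ) * diagonal (hprof m k : (Fin d → Fin S) → ℝ) := by
  have hPunit : IsUnit P.det :=
    (Matrix.isUnit_iff_isUnit_det P).mp (isUnit_of_coercive hγ (padded_coercive hcoer hP))
  have hHX : diagonal (hprof m k : (Fin d → Fin S) → ℝ) * diagonal (cubeInd m k : (Fin d → Fin S) → ℝ) = diagonal (hprof m k : (Fin d → Fin S) → ℝ) := by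
    rw [diagonal_mul_diagonal]
    congr 1
    funext x
    rw [mul_comm]
    exact cubeInd_mul_hprof hm k x
  have hXH : diagonal (cubeInd m k : (Fin d → Fin S) → ℝ) * diagonal (hprof m k : (Fin d → Fin S) → ℝ) = diagonal (hprof m k : (Fin d → Fin S) → ℝ) := by
    rw [diagonal_mul_diagonal]
    congr 1
    funext x
    exact cubeInd_mul_hprof hm k x
  have hXDX : diagonal (cubeInd m k : (Fin d → Fin S) → ℝ) * Dm * diagonal (cubeInd m k : (Fin d → Fin S) → ℝ) =
      P - γ • ((1 : Matrix (Fin d → Fin S) (Fin d → Fin S) ℝ) - diagonal (cubeInd m k : (Fin d → Fin S) → ℝ)) := by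
    ext x y
    rw [Matrix.mul_diagonal, Matrix.diagonal_mul, Matrix.sub_apply, Matrix.smul_apply, Matrix.sub_apply,
      Matrix.one_apply, Matrix.diagonal_apply, hP, smul_eq_mul]
    by_cases hxy : x = y
    · subst hxy
      rw [if_pos rfl, if_pos rfl]
      ring
    · rw [if_neg hxy, if_neg hxy]
      ring
  have hH1X : diagonal (hprof m k : (Fin d → Fin S) → ℝ) * ((1 : Matrix (Fin d → Fin S) (Fin d → Fin S) ℝ) - diagonal (cubeInd m k : (Fin d → Fin S) → ℝ)) = 0 := by
    rw [Matrix.mul_sub, Matrix.mul_one, hHX, sub_self]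
  calc diagonal (hprof m k : (Fin d → Fin S) → ℝ) * Dm * (diagonal (cubeInd m k : (Fin d → Fin S) → ℝ) * P⁻¹ * diagonal (cubeInd m k : (Fin d → Fin S) → ℝ)) * diagonal (hprof m k : (Fin d → Fin S) → ℝ)
      = diagonal (hprof m k : (Fin d → Fin S) → ℝ) * diagonal (cubeInd m k : (Fin d → Fin S) → ℝ) * Dm * (diagonal (cubeInd m k : (Fin d → Fin S) → ℝ) * P⁻¹ * diagonal (cubeInd m k : (Fin d → Fin S) → ℝ)) *
          diagonal (hprof m k : (Fin d → Fin S) → ℝ) := by rw [hHX]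
    _ = diagonal (hprof m k : (Fin d → Fin S) → ℝ) * (diagonal (cubeInd m k : (Fin d → Fin S) → ℝ) * Dm * diagonal (cubeInd m k : (Fin d → Fin S) → ℝ)) * P⁻¹ *
          (diagonal (cubeInd m k : (Fin d → Fin S) → ℝ) * diagonal (hprof m k : (Fin d → Fin S) → ℝ)) := by
        simp only [Matrix.mul_assoc]
    _ = diagonal (hprof m k : (Fin d → Fin S) → ℝ) * (P - γ • ((1 : Matrix (Fin d → Fin S) (Fin d → Fin S) ℝ) - diagonal (cubeInd m k : (Fin d → Fin S) → ℝ))) *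
          P⁻¹ * diagonal (hprof m k : (Fin d → Fin S) → ℝ) := by rw [hXDX, hXH]
    _ = (diagonal (hprof m k : (Fin d → Fin S) → ℝ) * P -
          γ • (diagonal (hprof m k : (Fin d → Fin S) → ℝ) * ((1 : Matrix (Fin d → Fin S) (Fin d → Fin S) ℝ) - diagonal (cubeInd m k : (Fin d → Fin S) → ℝ)))) *
          P⁻¹ * diagonal (hprof m k : (Fin d → Fin S) → ℝ) := by rw [Matrix.mul_sub, Matrix.mul_smul]
    _ = diagonal (hprof m k : (Fin d → Fin S) → ℝ) * P * P⁻¹ * diagonal (hprof m k : (Fin d → Fin S) → ℝ) := by rw [hH1X, smul_zero, sub_zero]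
    _ = diagonal (hprof m k : (Fin d → Fin S) → ℝ) * diagonal (hprof m k : (Fin d → Fin S) → ℝ) := by
        rw [Matrix.mul_assoc (diagonal (hprof m k : (Fin d → Fin S) → ℝ)) P, Matrix.mul_nonsing_inv P hPunit, Matrix.mul_one]

end LocalInverse


/-! ## §3. Proposition 2.2 (2.67)₁ for `G′ = Δ′_a⁻¹` on the one-scale box: the inputs of `box_kernel266_of_243` discharged -/

section Prop22

variable {n m : ℕ}

/-- The cut-off `h_k` of (2.36), as the linear map of the diagonal matrix, acts by multiplication by `h_k(x)`.
[cite: Balaban1984PropagatorsII, (2.36) p.229] -/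
theorem toLin_diagonal_apply (f μ : (Fin d → Fin S) → ℝ) (z : Fin d → Fin S) :
    Matrix.toLin' (diagonal f) μ z = f z * μ z := by
  rw [Matrix.toLin'_apply, mulVec_diagonal]

/-- Matrix entries ↔ operators (the kernel dictionary of the pairing (2.69) with unit weights on one scale, cf.
`B6Prop23Chain.mat`): `toLin' M (δ_{z′})(z) = M(z, z′)`. [cite: Balaban1984PropagatorsII, (2.69) p.235] -/
theorem toLin_single_apply (M : Matrix (Fin d → Fin S) (Fin d → Fin S) ℝ) (z z' : Fin d → Fin S) :
    Matrix.toLin' M (Pi.single z' 1) z = M z z' := by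
  rw [Matrix.toLin'_apply, mulVec_single_one_apply]

/-- `G′Δ′_a = I` for *"the operator G′ = Δ′_a^{−1}"* (Prop. 2.2), Δ′_a coercive (hence invertible: the positivity (2.11)).
[cite: Balaban1984PropagatorsII, (2.11) p.225] -/
theorem toLin_inv_mul {Dm : Matrix (Fin d → Fin S) (Fin d → Fin S) ℝ} {γ : ℝ} (hγ : 0 < γ) (hcoer : Coercive Dm γ) :
    Matrix.toLin' Dm⁻¹ * Matrix.toLin' Dm = 1 := by
  have hDunit : IsUnit Dm.det := (Matrix.isUnit_iff_isUnit_det Dm).mp (isUnit_of_coercive hγ hcoer)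
  rw [Module.End.mul_eq_comp, ← Matrix.toLin'_mul, Matrix.nonsing_inv_mul _ hDunit, Matrix.toLin'_one,
    Module.End.one_eq_id]

/-- The local-inverse property `h_kΔ′_aG′(□_k)h_k = h_kh_k` for the linear maps (from `localInverse_identity`).
[cite: Balaban1984PropagatorsII, (2.37)–(2.38) p.229] -/
theorem toLin_localInverse_identity {Dm P : Matrix (Fin d → Fin S) (Fin d → Fin S) ℝ} {γ : ℝ} {k : Fin d → Fin (n + 1)}
    (hm : 0 < m) (hγ : 0 < γ) (hcoer : Coercive Dm γ)
    (hP : ∀ x y, P x y = cubeInd m k x * Dm x y * cubeInd m k y +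
      γ * (1 - cubeInd m k x) * (if x = y then 1 else 0)) :
    Matrix.toLin' (diagonal (hprof m k : (Fin d → Fin S) → ℝ)) * Matrix.toLin' Dm *
        Matrix.toLin' (diagonal (cubeInd m k : (Fin d → Fin S) → ℝ) * P⁻¹ * diagonal (cubeInd m k : (Fin d → Fin S) → ℝ)) *
        Matrix.toLin' (diagonal (hprof m k : (Fin d → Fin S) → ℝ)) =
      Matrix.toLin' (diagonal (hprof m k : (Fin d → Fin S) → ℝ)) *
        Matrix.toLin' (diagonal (hprof m k : (Fin d → Fin S) → ℝ)) := by
  simp only [Module.End.mul_eq_comp, ← Matrix.toLin'_mul]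
  rw [localInverse_identity hm hγ hcoer hP]

/-- The weighted range `Σ_{z′}|Δ′_a(z,z′)|·|z−z′|₁e^{δ₀|z−z′|₁} ≤ κ₀e^{δ₀}` of a nearest-neighbour Δ′_a (the chain's `hD`).
[cite: Balaban1984PropagatorsII, (2.40) p.230] -/
theorem toLin_weightedRange {Dm : Matrix (Fin d → Fin (n * m + 1)) (Fin d → Fin (n * m + 1)) ℝ} {δ₀ κ₀ : ℝ} (hδ₀ : 0 ≤ δ₀)
    (hnn : ∀ x y, 1 < bdist x y → Dm x y = 0)
    (hrow : ∀ x, ∑ y ∈ Finset.univ.filter (fun y => y ≠ x), |Dm x y| ≤ κ₀) (z : Fin d → Fin (n * m + 1)) :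
    ∑ z', |Matrix.toLin' Dm (Pi.single z' 1) z| * (bdist z z' * Real.exp (δ₀ * bdist z z')) ≤ κ₀ * Real.exp δ₀ :=
  B6Ineq244BoxProof.weightedRange_of_nearestNeighbour hδ₀ (Matrix.toLin' Dm)
    (fun z z' hzz' => by rw [toLin_single_apply]; exact hnn z z' hzz')
    (fun z => by simp_rw [toLin_single_apply]; exact hrow z) z

/-- (2.43)₁ for the linear maps of the Dirichlet local inverses (from `localInverse_decay`): the `h243` of the chain.
[cite: Balaban1984PropagatorsII, (2.43) p.230] -/
theorem toLin_localInverse_decay {Dm P : Matrix (Fin d → Fin S) (Fin d → Fin S) ℝ} {γ δ₀ κ₀ : ℝ} {k : Fin d → Fin (n + 1)}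
    (hsymm : Dm.IsSymm) (hcoer : Coercive Dm γ) (hδ₀ : 0 ≤ δ₀) (hρ : κ₀ * (Real.exp δ₀ - 1) < γ)
    (hnn : ∀ x y, 1 < bdist x y → Dm x y = 0)
    (hrow : ∀ x, ∑ y ∈ Finset.univ.filter (fun y => y ≠ x), |Dm x y| ≤ κ₀)
    (hP : ∀ x y, P x y = cubeInd m k x * Dm x y * cubeInd m k y +
      γ * (1 - cubeInd m k x) * (if x = y then 1 else 0)) (z' z : Fin d → Fin S) :
    |Matrix.toLin' (diagonal (cubeInd m k : (Fin d → Fin S) → ℝ) * P⁻¹ * diagonal (cubeInd m k : (Fin d → Fin S) → ℝ))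
        (Pi.single z' 1) z| ≤ (γ - κ₀ * (Real.exp δ₀ - 1))⁻¹ * Real.exp (-(δ₀ * bdist z z')) := by
  rw [toLin_single_apply, Matrix.mul_diagonal, Matrix.diagonal_mul]
  exact localInverse_decay hsymm hcoer hδ₀ hρ hnn hrow hP z z'

/-- **PROPOSITION 2.2, FIRST ENTRY OF (2.67), ON THE ONE-SCALE BOX MODEL WITH NO DISPLAYED HYPOTHESIS LEFT.**  p. 234:
*"If we have (2.1), (2.2) and M is sufficiently large, then the operator G′ = Δ′_a^{−1} (a = 1) satisfies the inequalities
|(G′λ)(x)| … ≤ O(1)(L^jη)² e^{−½δ₀d(y,y′)}|λ|"* (2.67); p. 235: *"If we have one scale … the operator is a unit lattice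
operator."*  On the box {0,…,nM}^d (blocks = sites; Q′₀ = I, so Δ′_a of (2.13) is a nearest-neighbour unit-lattice
operator), for EVERY symmetric matrix `Δ′_a` with `⟨v, Δ′_av⟩ ≥ γ‖v‖²` (γ > 0, the positivity (2.11)), `Δ′_a(x,y) = 0` for
`|x − y|₁ > 1` and off-diagonal absolute row sums `≤ κ₀`, every `δ₀ > 0` with `κ₀(e^{δ₀} − 1) < γ`, every `0 < α ≤ 1`, and
*"M sufficiently large"* EXPLICITLY **`M > 2^d·(3π/2)·A·κ₀e^{δ₀}·K(αδ₀)`** (A = (γ − κ₀(e^{δ₀} − 1))⁻¹, K = `B6CoverBox.Kbox`):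
**`|Δ′_a⁻¹(x,y)| ≤ 2^dA·K(αδ₀)·(1 − 2^d(3π/2)Aκ₀e^{δ₀}M⁻¹K(αδ₀))⁻¹·e^{−(1−α)δ₀|x−y|₁}`**, uniformly in the volume n — PROVED
ALONG THE PRINTED ROUTE: cover and cut-offs of (2.36) (`B6CoverBox`), Dirichlet local inverses with (2.43)₁
(`localInverse_decay`) and the local-inverse property of (2.37)–(2.38) (`localInverse_identity`), (2.44) from (2.43) and the
random walk (2.50)/(2.64)–(2.66) with Lemma 2.1 as (2.61)′/(2.63)′ (`B6Ineq244BoxProof.box_kernel266_of_243`, every input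
discharged).  (On this model the conclusion is also one line from `inv_entry_decay` for Δ′_a itself; certified here is the
printed route.) [cite: Balaban1984PropagatorsII, Prop. 2.2 (2.67) p.234] -/
theorem prop22_entry1_box (hm : 0 < m) {γ δ₀ κ₀ α : ℝ} (hγ : 0 < γ) (hδ₀ : 0 < δ₀) (hα : 0 < α) (hα1 : α ≤ 1)
    (Dm : Matrix (Fin d → Fin (n * m + 1)) (Fin d → Fin (n * m + 1)) ℝ) (hsymm : Dm.IsSymm) (hcoer : Coercive Dm γ)
    (hnn : ∀ x y, 1 < bdist x y → Dm x y = 0)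
    (hrow : ∀ x, ∑ y ∈ Finset.univ.filter (fun y => y ≠ x), |Dm x y| ≤ κ₀)
    (hρ : κ₀ * (Real.exp δ₀ - 1) < γ)
    (hM : (2 : ℝ) ^ d * (3 * Real.pi / 2 * (γ - κ₀ * (Real.exp δ₀ - 1))⁻¹ * (κ₀ * Real.exp δ₀)) * Kbox d (α * δ₀) < m)
    (x y : Fin d → Fin (n * m + 1)) :
    |Dm⁻¹ x y| ≤ (2 : ℝ) ^ d * (γ - κ₀ * (Real.exp δ₀ - 1))⁻¹ * Kbox d (α * δ₀) *
        (1 - (2 : ℝ) ^ d * (3 * Real.pi / 2 * (γ - κ₀ * (Real.exp δ₀ - 1))⁻¹ * (κ₀ * Real.exp δ₀) / m) *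
          Kbox d (α * δ₀))⁻¹ * Real.exp (-((1 - α) * δ₀ * bdist x y)) := by
  classical
  have hκ₀ : 0 ≤ κ₀ := le_trans (Finset.sum_nonneg fun y _ => abs_nonneg _) (hrow x)
  have hApos : 0 < (γ - κ₀ * (Real.exp δ₀ - 1))⁻¹ := by
    refine inv_pos.mpr ?_
    have : 0 ≤ κ₀ * (Real.exp δ₀ - 1) := mul_nonneg hκ₀ (by linarith [Real.add_one_le_exp δ₀])
    linarith
  -- the padded compressions P_k = □_kΔ′_a□_k + γ(1 − □_k) and the Dirichlet local inverses □_kP_k⁻¹□_k (§2)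
  set P : (Fin d → Fin (n + 1)) → Matrix (Fin d → Fin (n * m + 1)) (Fin d → Fin (n * m + 1)) ℝ := fun k =>
    Matrix.of fun x y => cubeInd m k x * Dm x y * cubeInd m k y + γ * (1 - cubeInd m k x) * (if x = y then 1 else 0)
    with hPdef
  have hP : ∀ k x y, P k x y =
      cubeInd m k x * Dm x y * cubeInd m k y + γ * (1 - cubeInd m k x) * (if x = y then 1 else 0) :=
    fun k x y => rfl
  -- the operators of the chain: D = Δ′_a, Gp = Δ′_a⁻¹, h_k = multiplication by the cut-off, gl_k = G′(□_k)
  set D : Module.End ℝ ((Fin d → Fin (n * m + 1)) → ℝ) := Matrix.toLin' Dm with hDdef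
  set Gp : Module.End ℝ ((Fin d → Fin (n * m + 1)) → ℝ) := Matrix.toLin' Dm⁻¹ with hGpdef
  set h : (Fin d → Fin (n + 1)) → Module.End ℝ ((Fin d → Fin (n * m + 1)) → ℝ) := fun k =>
    Matrix.toLin' (diagonal (hprof m k)) with hhdef
  set gl : (Fin d → Fin (n + 1)) → Module.End ℝ ((Fin d → Fin (n * m + 1)) → ℝ) := fun k =>
    Matrix.toLin' (diagonal (cubeInd m k) * (P k)⁻¹ * diagonal (cubeInd m k)) with hgldef
  have key := B6Ineq244BoxProof.box_kernel266_of_243 hm (mul_pos hα hδ₀) hδ₀.le hα1 hApos.le (by positivity)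
    D Gp h gl (fun k μ z => toLin_diagonal_apply _ μ z) (toLin_inv_mul hγ hcoer) (fun k => toLin_localInverse_identity hm hγ hcoer (hP k))
    (toLin_weightedRange hδ₀.le hnn hrow) (fun k z' z => toLin_localInverse_decay hsymm hcoer hδ₀.le hρ hnn hrow (hP k) z' z) hM x y
  rwa [toLin_single_apply] at key

end Prop22

end Literature.MathematicalPhysics.QuantumFieldTheory.Balaban1983to89.B6Ineq243BoxProof
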